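import Mathlib
import HarnessLib

/-!
# `StaticScoreResponse` (support item stmt-AtomisticToContinuum-12269): real-analysis helpers

Elementary real-variable lemmas used in the proof of the support item `StaticScoreResponse` of the
routes `OneSphereInfluence` / `CramerRaoSaturation` (sub-problem `HydrodynamicLimit`), where the
convergence of covariances `Cov(S_κ, ⟨U_N(0), χ⟩)` (second derivatives of canonical log-partition
functions) is deduced from the convergence of means (first derivatives, the law of large numbers)
and uniform bounds on third derivatives (Cauchy estimates):

* `uniformCauchySeqOn_of_taylor_bound` — if `|D_n(κ, s) - D_n(κ, 0) - s V_n(κ)| ≤ K s²` for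
  `0 < s ≤ δ` and `D_n(·, s)` is uniformly Cauchy in `κ` for each fixed `s`, then `V_n` is uniformly
  Cauchy (second derivatives at `0` converge as soon as first derivatives converge pointwise and
  third derivatives are bounded);
* `uniformCauchySeqOn_of_equicontinuous` — a pointwise Cauchy, uniformly equicontinuous sequence of
  real functions on a compact set of a metric space is uniformly Cauchy;
* `exists_tendstoUniformlyOn_of_uniformCauchySeqOn` — a uniformly Cauchy sequence of real functions
  converges uniformly to some function;
* `derivWithin_eq_of_tendsto_of_tendstoUniformlyOn` — if `f_n → g` pointwise on `(0,1)`, the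
  derivatives `f_n'` converge uniformly on `(0,1)` to a function `G` continuous on `[0,1]`, and `g`
  is differentiable within `[0,1]` at every point, then its one-sided/within derivative is `G` on
  all of `[0,1]` (endpoints included).

Everything is folklore real analysis; no definitions, no named facts.
-/

noncomputable section

namespace Summit.AtomisticToContinuum.HydrodynamicLimit.Theorems

open Filter Set Metric Topology

/-! ### Second derivatives from first derivatives and third-derivative bounds -/

/-- **Uniform Cauchy criterion for "second derivatives".** If for every `n`, every parameter
`κ ∈ S` and every `0 < s ≤ δ` the Taylor-type bound `|D n κ s - D n κ 0 - s * V n κ| ≤ K s²` holds,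
and for every fixed `s ∈ [0, δ]` the sequence `n ↦ D n · s` is uniformly Cauchy on `S`, then
`n ↦ V n` is uniformly Cauchy on `S`. (With `D n κ = φₙ'(κ, ·)` and `V n κ = φₙ''(κ, 0)` this is the
statement that second derivatives converge uniformly once first derivatives converge and third
derivatives are uniformly bounded.) [folklore] -/
theorem uniformCauchySeqOn_of_taylor_bound {ι : Type*} {S : Set ι} {D : ℕ → ι → ℝ → ℝ}
    {V : ℕ → ι → ℝ} {K δ : ℝ} (hδ : 0 < δ) (hK : 0 ≤ K)
    (hT : ∀ n, ∀ κ ∈ S, ∀ s, 0 < s → s ≤ δ → |D n κ s - D n κ 0 - s * V n κ| ≤ K * s ^ 2)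
    (hD : ∀ s, 0 ≤ s → s ≤ δ → UniformCauchySeqOn (fun n κ => D n κ s) atTop S) :
    UniformCauchySeqOn V atTop S := by
  rw [Metric.uniformCauchySeqOn_iff]
  intro ε hε
  -- the step `s`
  set s : ℝ := min δ (ε / (4 * (K + 1))) with hs_def
  have hK1 : 0 < K + 1 := by linarith
  have hs_pos : 0 < s := lt_min hδ (by positivity)
  have hs_le : s ≤ δ := min_le_left _ _
  have hs_le' : s ≤ ε / (4 * (K + 1)) := min_le_right _ _
  have hKs : 2 * K * s < ε / 2 := by
    have h1 : 2 * K * s ≤ 2 * K * (ε / (4 * (K + 1))) := by nlinarith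
    have h2 : 2 * K * (ε / (4 * (K + 1))) = (K / (K + 1)) * (ε / 2) := by
      field_simp
      ring
    have h3 : K / (K + 1) < 1 := by rw [div_lt_one hK1]; linarith
    have h4 : (K / (K + 1)) * (ε / 2) < 1 * (ε / 2) := by
      exact mul_lt_mul_of_pos_right h3 (by positivity)
    linarith
  -- Cauchy property of `D · · s` and `D · · 0` at precision `ε s / 4`
  have hεs : 0 < ε * s / 4 := by positivity
  obtain ⟨N₁, hN₁⟩ := Metric.uniformCauchySeqOn_iff.1 (hD s hs_pos.le hs_le) (ε * s / 4) hεs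
  obtain ⟨N₀, hN₀⟩ := Metric.uniformCauchySeqOn_iff.1 (hD 0 le_rfl hδ.le) (ε * s / 4) hεs
  refine ⟨max N₀ N₁, fun m hm n hn κ hκ => ?_⟩
  have hm₀ : N₀ ≤ m := (le_max_left _ _).trans hm
  have hm₁ : N₁ ≤ m := (le_max_right _ _).trans hm
  have hn₀ : N₀ ≤ n := (le_max_left _ _).trans hn
  have hn₁ : N₁ ≤ n := (le_max_right _ _).trans hn
  have h1 := hN₁ m hm₁ n hn₁ κ hκ
  have h0 := hN₀ m hm₀ n hn₀ κ hκ
  rw [Real.dist_eq] at h1 h0 ⊢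
  have hTm := hT m κ hκ s hs_pos hs_le
  have hTn := hT n κ hκ s hs_pos hs_le
  -- `s (V m - V n) = ΔD(s) - ΔD(0) - (R m - R n)`
  have hkey : |s * (V m κ - V n κ)| ≤ ε * s / 4 + ε * s / 4 + 2 * K * s ^ 2 := by
    have : s * (V m κ - V n κ) = (D m κ s - D n κ s) - (D m κ 0 - D n κ 0)
        - ((D m κ s - D m κ 0 - s * V m κ) - (D n κ s - D n κ 0 - s * V n κ)) := by ring
    rw [this]
    calc |(D m κ s - D n κ s) - (D m κ 0 - D n κ 0)
          - ((D m κ s - D m κ 0 - s * V m κ) - (D n κ s - D n κ 0 - s * V n κ))|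
        ≤ |(D m κ s - D n κ s) - (D m κ 0 - D n κ 0)|
          + |(D m κ s - D m κ 0 - s * V m κ) - (D n κ s - D n κ 0 - s * V n κ)| := abs_sub _ _
      _ ≤ (|D m κ s - D n κ s| + |D m κ 0 - D n κ 0|)
          + (|D m κ s - D m κ 0 - s * V m κ| + |D n κ s - D n κ 0 - s * V n κ|) :=
          add_le_add (abs_sub _ _) (abs_sub _ _)
      _ ≤ (ε * s / 4 + ε * s / 4) + (K * s ^ 2 + K * s ^ 2) := by gcongr
      _ = _ := by ring
  rw [abs_mul, abs_of_pos hs_pos] at hkey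
  have hdiv : |V m κ - V n κ| ≤ ε / 4 + ε / 4 + 2 * K * s := by
    have h := div_le_div_of_nonneg_right hkey hs_pos.le
    rw [mul_div_cancel_left₀ _ hs_pos.ne'] at h
    refine h.trans (le_of_eq ?_)
    field_simp
  linarith

/-! ### Uniform Cauchy sequences from equicontinuity -/

/-- **Pointwise Cauchy + uniform equicontinuity on a compact set ⇒ uniformly Cauchy** (the easy
half of the Arzelà–Ascoli circle of ideas): if the real functions `F n` are uniformly equicontinuous
on the compact set `s` of a metric space, uniformly in `n`, and `n ↦ F n x` is Cauchy for every
`x ∈ s`, then `F` is uniformly Cauchy on `s`. [folklore] -/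
theorem uniformCauchySeqOn_of_equicontinuous {X : Type*} [PseudoMetricSpace X] {s : Set X}
    (hs : IsCompact s) {F : ℕ → X → ℝ}
    (hequi : ∀ ε > (0 : ℝ), ∃ ρ > (0 : ℝ), ∀ n, ∀ x ∈ s, ∀ y ∈ s, dist x y < ρ →
      dist (F n x) (F n y) < ε)
    (hpt : ∀ x ∈ s, CauchySeq fun n => F n x) :
    UniformCauchySeqOn F atTop s := by
  rw [Metric.uniformCauchySeqOn_iff]
  intro ε hε
  have hε3 : 0 < ε / 3 := by positivity
  obtain ⟨ρ, hρ, hρF⟩ := hequi (ε / 3) hε3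
  obtain ⟨t, hts, htfin, hcover⟩ := finite_cover_balls_of_compact hs hρ
  -- a common index beyond which every `F · y`, `y ∈ t`, oscillates by less than `ε / 3`
  have hev : ∀ y ∈ t, ∀ᶠ p : ℕ × ℕ in atTop, dist (F p.1 y) (F p.2 y) < ε / 3 := by
    intro y hy
    have hc := Metric.cauchySeq_iff.1 (hpt y (hts hy)) (ε / 3) hε3
    obtain ⟨N, hN⟩ := hc
    rw [eventually_atTop]
    exact ⟨(N, N), fun p hp => hN p.1 hp.1 p.2 hp.2⟩
  have hall : ∀ᶠ p : ℕ × ℕ in atTop, ∀ y ∈ t, dist (F p.1 y) (F p.2 y) < ε / 3 :=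
    (htfin.eventually_all (l := atTop) (p := fun y (p : ℕ × ℕ) => dist (F p.1 y) (F p.2 y) < ε / 3)).2 hev
  obtain ⟨⟨N₁, N₂⟩, hN⟩ := eventually_atTop.1 hall
  refine ⟨max N₁ N₂, fun m hm n hn x hx => ?_⟩
  obtain ⟨y, hy, hxy⟩ : ∃ y ∈ t, x ∈ ball y ρ := by
    have := hcover hx
    simpa only [mem_iUnion, exists_prop] using this
  have hys : y ∈ s := hts hy
  have hmn : ((N₁, N₂) : ℕ × ℕ) ≤ (m, n) :=
    ⟨(le_max_left _ _).trans hm, (le_max_right _ _).trans hn⟩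
  have h2 := hN (m, n) hmn y hy
  have h1 := hρF m x hx y hys (mem_ball.1 hxy)
  have h3 := hρF n x hx y hys (mem_ball.1 hxy)
  calc dist (F m x) (F n x) ≤ dist (F m x) (F m y) + dist (F m y) (F n x) := dist_triangle _ _ _
    _ ≤ dist (F m x) (F m y) + (dist (F m y) (F n y) + dist (F n y) (F n x)) :=
        add_le_add le_rfl (dist_triangle _ _ _)
    _ < ε / 3 + (ε / 3 + ε / 3) := by
        gcongr
        rwa [dist_comm]
    _ = ε := by ring

/-- A uniformly Cauchy sequence of real functions on a set converges uniformly on that set to some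
function (completeness of `ℝ`). [folklore] -/
theorem exists_tendstoUniformlyOn_of_uniformCauchySeqOn {X : Type*} {s : Set X} {F : ℕ → X → ℝ}
    (hF : UniformCauchySeqOn F atTop s) :
    ∃ f : X → ℝ, TendstoUniformlyOn F f atTop s := by
  have hlim : ∀ x ∈ s, ∃ l, Tendsto (fun n => F n x) atTop (𝓝 l) := fun x hx =>
    cauchySeq_tendsto_of_complete (hF.cauchySeq hx)
  refine ⟨fun x => limUnder atTop fun n => F n x, hF.tendstoUniformlyOn_of_tendsto fun x hx => ?_⟩
  exact tendsto_nhds_limUnder (hlim x hx)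

/-! ### Identification of the derivative of a limit, up to the endpoints of `[0, 1]` -/

/-- Mean-value step: if the functions `f n` are differentiable on `(0,1)` with derivatives `f' n`,
converge pointwise on `(0,1)` to `g`, and eventually `|f' n x - c| ≤ B` on `[p, q] ⊆ (0,1)`, then
`|g q - g p - (q - p) c| ≤ B (q - p)`. [folklore] -/
theorem abs_sub_sub_mul_le_of_tendsto {f f' : ℕ → ℝ → ℝ} {g : ℝ → ℝ}
    (hder : ∀ n, ∀ x ∈ Ioo (0 : ℝ) 1, HasDerivAt (f n) (f' n x) x)
    (hf : ∀ x ∈ Ioo (0 : ℝ) 1, Tendsto (fun n => f n x) atTop (𝓝 (g x)))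
    {p q c B : ℝ} (hp : 0 < p) (hpq : p ≤ q) (hq : q < 1)
    (hB : ∀ᶠ n in atTop, ∀ x ∈ Icc p q, |f' n x - c| ≤ B) :
    |g q - g p - (q - p) * c| ≤ B * (q - p) := by
  have hpI : p ∈ Ioo (0 : ℝ) 1 := ⟨hp, hpq.trans_lt hq⟩
  have hqI : q ∈ Ioo (0 : ℝ) 1 := ⟨hp.trans_le hpq, hq⟩
  -- the estimate for each large `n`
  have hn : ∀ᶠ n in atTop, |f n q - f n p - (q - p) * c| ≤ B * (q - p) := by
    filter_upwards [hB] with n hBn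
    have hmvt := Convex.norm_image_sub_le_of_norm_hasDerivWithin_le
      (f := fun x => f n x - c * x) (f' := fun x => f' n x - c) (s := Icc p q)
      (fun x hx => ((hder n x ⟨hp.trans_le hx.1, hx.2.trans_lt hq⟩).sub
        ((hasDerivAt_id x).const_mul c)).hasDerivWithinAt.congr_deriv (by simp))
      (fun x hx => by simpa [Real.norm_eq_abs] using hBn x hx) (convex_Icc p q)
      (left_mem_Icc.2 hpq) (right_mem_Icc.2 hpq)
    have hqp : ‖q - p‖ = q - p := by rw [Real.norm_eq_abs, abs_of_nonneg (sub_nonneg.2 hpq)]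
    rw [hqp, Real.norm_eq_abs] at hmvt
    have : f n q - c * q - (f n p - c * p) = f n q - f n p - (q - p) * c := by ring
    rwa [this] at hmvt
  -- pass to the limit
  have hlim : Tendsto (fun n => |f n q - f n p - (q - p) * c|) atTop
      (𝓝 |g q - g p - (q - p) * c|) :=
    (((hf q hqI).sub (hf p hpI)).sub tendsto_const_nhds).abs
  exact le_of_tendsto hlim hn

/-- **The within-`[0,1]` derivative of a limit.** Let `f n → g` pointwise on `(0,1)`, where each
`f n` is differentiable on `(0,1)` with derivative `f' n`, and let `f' n → G` uniformly on `(0,1)`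
with `G` continuous on `[0,1]`. If `g` is differentiable within `[0,1]` at every point of `[0,1]`
(with some derivative `gd`), then `gd = G` on `[0,1]`, endpoints included (mean value inequality on
interior segments, continuity of `g` within `[0,1]`, uniqueness of one-sided derivatives).
[folklore] -/
theorem eq_of_tendsto_of_tendstoUniformlyOn_deriv {f f' : ℕ → ℝ → ℝ} {g G gd : ℝ → ℝ}
    (hder : ∀ n, ∀ x ∈ Ioo (0 : ℝ) 1, HasDerivAt (f n) (f' n x) x)
    (hf : ∀ x ∈ Ioo (0 : ℝ) 1, Tendsto (fun n => f n x) atTop (𝓝 (g x)))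
    (hf' : TendstoUniformlyOn f' G atTop (Ioo 0 1)) (hG : ContinuousOn G (Icc 0 1))
    (hg : ∀ κ ∈ Icc (0 : ℝ) 1, HasDerivWithinAt g (gd κ) (Icc 0 1) κ) :
    ∀ κ ∈ Icc (0 : ℝ) 1, gd κ = G κ := by
  intro κ hκ
  have hU : UniqueDiffWithinAt ℝ (Icc (0 : ℝ) 1) κ := uniqueDiffOn_Icc_zero_one κ hκ
  refine hU.eq_deriv _ (hg κ hκ) ?_
  -- continuity of `g` within `[0,1]`
  have hgc : ∀ x ∈ Icc (0 : ℝ) 1, ContinuousWithinAt g (Icc 0 1) x :=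
    fun x hx => (hg x hx).continuousWithinAt
  -- key two-point estimate on interior segments near `κ`
  have key : ∀ ε > (0 : ℝ), ∃ ρ > (0 : ℝ), ∀ p q : ℝ, 0 < p → p ≤ q → q < 1 →
      (∀ x ∈ Icc p q, |x - κ| < ρ) → |g q - g p - (q - p) * G κ| ≤ ε * (q - p) := by
    intro ε hε
    have hε2 : 0 < ε / 2 := half_pos hε
    -- continuity of `G` at `κ` within `[0,1]`
    obtain ⟨ρ, hρ, hρG⟩ : ∃ ρ > (0 : ℝ), ∀ x ∈ Icc (0 : ℝ) 1, |x - κ| < ρ → |G x - G κ| ≤ ε / 2 := by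
      have hc := Metric.continuousWithinAt_iff.1 (hG κ hκ) (ε / 2) hε2
      obtain ⟨ρ, hρ, h⟩ := hc
      exact ⟨ρ, hρ, fun x hx hxκ => (le_of_lt (by simpa [Real.dist_eq] using h hx hxκ))⟩
    refine ⟨ρ, hρ, fun p q hp hpq hq hnear => ?_⟩
    refine abs_sub_sub_mul_le_of_tendsto hder hf hp hpq hq ?_
    have hu := Metric.tendstoUniformlyOn_iff.1 hf' (ε / 2) hε2
    filter_upwards [hu] with n hn x hx
    have hxI : x ∈ Ioo (0 : ℝ) 1 := ⟨hp.trans_le hx.1, hx.2.trans_lt hq⟩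
    have h1 : |G x - f' n x| < ε / 2 := by simpa [Real.dist_eq] using hn x hxI
    have h2 := hρG x ⟨hxI.1.le, hxI.2.le⟩ (hnear x hx)
    calc |f' n x - G κ| = |(f' n x - G x) + (G x - G κ)| := by ring_nf
      _ ≤ |f' n x - G x| + |G x - G κ| := abs_add_le _ _
      _ ≤ ε / 2 + ε / 2 := add_le_add (by rw [abs_sub_comm]; exact h1.le) h2
      _ = ε := add_halves ε
  -- the within-derivative in `ε`-form
  rw [hasDerivWithinAt_iff_isLittleO, Asymptotics.isLittleO_iff]
  intro ε hε
  obtain ⟨ρ, hρ, hkey⟩ := key ε hε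
  have hball : ∀ᶠ y in 𝓝[Icc (0 : ℝ) 1] κ, |y - κ| < ρ ∧ y ∈ Icc (0 : ℝ) 1 := by
    refine Filter.Eventually.and ?_ eventually_mem_nhdsWithin
    have : ∀ᶠ y in 𝓝 κ, |y - κ| < ρ := by
      have := Metric.ball_mem_nhds κ hρ
      filter_upwards [this] with y hy
      rwa [mem_ball, Real.dist_eq] at hy
    exact this.filter_mono nhdsWithin_le_nhds
  filter_upwards [hball] with y hy
  obtain ⟨hyρ, hyI⟩ := hy
  rw [Real.norm_eq_abs, Real.norm_eq_abs]
  simp only [smul_eq_mul]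
  rcases lt_trichotomy y κ with hlt | heq | hgt
  · -- `y < κ`: segments `[p, q]` with `y < p ≤ q < κ`, `p → y`, `q → κ`
    have hκ0 : 0 < κ := hyI.1.trans_lt hlt
    have hy1 : y < 1 := hlt.trans_le hκ.2
    -- sequences
    set p : ℕ → ℝ := fun k => y + (κ - y) / (k + 3) with hp_def
    set q : ℕ → ℝ := fun k => κ - (κ - y) / (k + 3) with hq_def
    have hd : 0 < κ - y := sub_pos.2 hlt
    have hk3 : ∀ k : ℕ, (0 : ℝ) < k + 3 := fun k => by positivity
    have hfrac : ∀ k : ℕ, 0 < (κ - y) / (k + 3) := fun k => div_pos hd (hk3 k)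
    have hfrac' : ∀ k : ℕ, (κ - y) / (k + 3) ≤ (κ - y) / 3 := fun k =>
      div_le_div_of_nonneg_left hd.le (by norm_num) (by linarith [(Nat.cast_nonneg k : (0:ℝ) ≤ k)])
    have hest : ∀ k, |g (q k) - g (p k) - (q k - p k) * G κ| ≤ ε * (q k - p k) := by
      intro k
      refine hkey (p k) (q k) (by simp only [hp_def]; linarith [hfrac k, hyI.1]) ?_ ?_ ?_
      · simp only [hp_def, hq_def]; linarith [hfrac' k]
      · simp only [hq_def]; linarith [hfrac k, hκ.2]
      · intro x hx
        simp only [hp_def, hq_def] at hx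
        rw [abs_lt]
        constructor <;> nlinarith [hx.1, hx.2, hfrac k, abs_lt.1 hyρ]
    -- limits of the sequences
    have htend0 : Tendsto (fun k : ℕ => (κ - y) / ((k : ℝ) + 3)) atTop (𝓝 0) := by
      have h1 : Tendsto (fun k : ℕ => ((k : ℝ) + 3)) atTop atTop :=
        tendsto_atTop_add_const_right _ _ tendsto_natCast_atTop_atTop
      exact tendsto_const_nhds.div_atTop h1
    have hp_t : Tendsto p atTop (𝓝[Icc (0 : ℝ) 1] y) := by
      refine tendsto_nhdsWithin_iff.2 ⟨?_, Eventually.of_forall fun k => ?_⟩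
      · simpa [hp_def] using tendsto_const_nhds.add htend0
      · exact ⟨by simp only [hp_def]; linarith [hfrac k, hyI.1],
          by simp only [hp_def]; linarith [hfrac' k, hκ.2]⟩
    have hq_t : Tendsto q atTop (𝓝[Icc (0 : ℝ) 1] κ) := by
      refine tendsto_nhdsWithin_iff.2 ⟨?_, Eventually.of_forall fun k => ?_⟩
      · simpa [hq_def] using tendsto_const_nhds.sub htend0
      · exact ⟨by simp only [hq_def]; linarith [hfrac' k, hyI.1], by simp only [hq_def]; linarith [hfrac k, hκ.2]⟩
    have hgp : Tendsto (fun k => g (p k)) atTop (𝓝 (g y)) := (hgc y hyI).tendsto.comp hp_t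
    have hgq : Tendsto (fun k => g (q k)) atTop (𝓝 (g κ)) := (hgc κ hκ).tendsto.comp hq_t
    have hpq_t : Tendsto (fun k => q k - p k) atTop (𝓝 (κ - y)) := by
      have h1 : Tendsto p atTop (𝓝 y) := by simpa [hp_def] using tendsto_const_nhds.add htend0
      have h2 : Tendsto q atTop (𝓝 κ) := by simpa [hq_def] using tendsto_const_nhds.sub htend0
      exact h2.sub h1
    have hL : Tendsto (fun k => |g (q k) - g (p k) - (q k - p k) * G κ|) atTop
        (𝓝 |g κ - g y - (κ - y) * G κ|) :=
      ((hgq.sub hgp).sub (hpq_t.mul tendsto_const_nhds)).abs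
    have hR : Tendsto (fun k => ε * (q k - p k)) atTop (𝓝 (ε * (κ - y))) :=
      hpq_t.const_mul ε
    have hfin : |g κ - g y - (κ - y) * G κ| ≤ ε * (κ - y) :=
      le_of_tendsto_of_tendsto hL hR (Eventually.of_forall hest)
    have h1 : |g y - g κ - (y - κ) * G κ| = |g κ - g y - (κ - y) * G κ| := by
      rw [← abs_neg]; ring_nf
    rw [h1, abs_of_neg (sub_neg.2 hlt)]
    linarith
  · subst heq
    simp
  · -- `κ < y`: segments `[p, q]` with `κ < p ≤ q < y`, `p → κ`, `q → y`
    have hy0 : 0 < y := hκ.1.trans_lt hgt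
    have hκ1 : κ < 1 := hgt.trans_le hyI.2
    set p : ℕ → ℝ := fun k => κ + (y - κ) / (k + 3) with hp_def
    set q : ℕ → ℝ := fun k => y - (y - κ) / (k + 3) with hq_def
    have hd : 0 < y - κ := sub_pos.2 hgt
    have hk3 : ∀ k : ℕ, (0 : ℝ) < k + 3 := fun k => by positivity
    have hfrac : ∀ k : ℕ, 0 < (y - κ) / (k + 3) := fun k => div_pos hd (hk3 k)
    have hfrac' : ∀ k : ℕ, (y - κ) / (k + 3) ≤ (y - κ) / 3 := fun k =>
      div_le_div_of_nonneg_left hd.le (by norm_num) (by linarith [(Nat.cast_nonneg k : (0:ℝ) ≤ k)])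
    have hest : ∀ k, |g (q k) - g (p k) - (q k - p k) * G κ| ≤ ε * (q k - p k) := by
      intro k
      refine hkey (p k) (q k) (by simp only [hp_def]; linarith [hfrac k, hκ.1]) ?_ ?_ ?_
      · simp only [hp_def, hq_def]; linarith [hfrac' k]
      · simp only [hq_def]; linarith [hfrac k, hyI.2]
      · intro x hx
        simp only [hp_def, hq_def] at hx
        rw [abs_lt]
        constructor <;> nlinarith [hx.1, hx.2, hfrac k, abs_lt.1 hyρ]
    have htend0 : Tendsto (fun k : ℕ => (y - κ) / ((k : ℝ) + 3)) atTop (𝓝 0) := by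
      have h1 : Tendsto (fun k : ℕ => ((k : ℝ) + 3)) atTop atTop :=
        tendsto_atTop_add_const_right _ _ tendsto_natCast_atTop_atTop
      exact tendsto_const_nhds.div_atTop h1
    have hp_t : Tendsto p atTop (𝓝[Icc (0 : ℝ) 1] κ) := by
      refine tendsto_nhdsWithin_iff.2 ⟨?_, Eventually.of_forall fun k => ?_⟩
      · simpa [hp_def] using tendsto_const_nhds.add htend0
      · exact ⟨by simp only [hp_def]; linarith [hfrac k, hκ.1],
          by simp only [hp_def]; linarith [hfrac' k, hyI.2]⟩
    have hq_t : Tendsto q atTop (𝓝[Icc (0 : ℝ) 1] y) := by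
      refine tendsto_nhdsWithin_iff.2 ⟨?_, Eventually.of_forall fun k => ?_⟩
      · simpa [hq_def] using tendsto_const_nhds.sub htend0
      · exact ⟨by simp only [hq_def]; linarith [hfrac' k, hκ.1], by simp only [hq_def]; linarith [hfrac k, hyI.2]⟩
    have hgp : Tendsto (fun k => g (p k)) atTop (𝓝 (g κ)) := (hgc κ hκ).tendsto.comp hp_t
    have hgq : Tendsto (fun k => g (q k)) atTop (𝓝 (g y)) := (hgc y hyI).tendsto.comp hq_t
    have hpq_t : Tendsto (fun k => q k - p k) atTop (𝓝 (y - κ)) := by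
      have h1 : Tendsto p atTop (𝓝 κ) := by simpa [hp_def] using tendsto_const_nhds.add htend0
      have h2 : Tendsto q atTop (𝓝 y) := by simpa [hq_def] using tendsto_const_nhds.sub htend0
      exact h2.sub h1
    have hL : Tendsto (fun k => |g (q k) - g (p k) - (q k - p k) * G κ|) atTop
        (𝓝 |g y - g κ - (y - κ) * G κ|) :=
      ((hgq.sub hgp).sub (hpq_t.mul tendsto_const_nhds)).abs
    have hR : Tendsto (fun k => ε * (q k - p k)) atTop (𝓝 (ε * (y - κ))) :=
      hpq_t.const_mul ε
    have hfin : |g y - g κ - (y - κ) * G κ| ≤ ε * (y - κ) :=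
      le_of_tendsto_of_tendsto hL hR (Eventually.of_forall hest)
    rw [abs_of_pos (sub_pos.2 hgt)]
    linarith

end Summit.AtomisticToContinuum.HydrodynamicLimit.Theorems

end
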